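import Summits.QuantumFields.YangMills.Theorems.BalabanUVNodesN15KingModelGraphPowerCountingLowered

/-!
# BalabanUVNodes ∕ N15 — THE KING-MODEL RUNG (PART Γ-e): PROPOSITION 3.6's RATE FOR GENERAL GRAPHS — THE TWO MEMBERS BY NAME AT `A = 0`: the `S^c` terms of
# the fine graph are small (`L^{−γ(K+1)}`, Prop. 3.7 of the `(K+n)`-run by name) and the replacement step's majorant graphs summed over all assignments are
# bounded uniformly («for γ small enough»); the `S ∕ S^c` split and the margin bookkeeping of the degree constants
# (Track A, DAG node N15 = NE2; FAN-OUT v1.1 §N15 s3 «KING-MODEL RUNG … NE2's analogue DECIDED in the model»)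

HONEST FRAMING.  Count-neutral (cell `pub-ymgap`, seat `pub-ymgap-dag-n15-e` g27; `--supports stmt-QuantumFields-27366 --as helper` = K3⁸
`SpineGivenEndpointR13SepCoPHV`).  TEMPLATE LITERATURE: C. King, *The U(1) Higgs model. I. The continuum limit*, Commun. Math. Phys. **102** (1986) 649–677
[King1986], proof of Proposition 3.6, pp. 663–665.  The members of the (3.56)-rate for a GENERAL graph: King splits the fine run's slice assignments into
`S^c ≠ ∅` (some line finer than the coarse spacing: bounded by SIZE, the finest line yielding `L^{−γ(k+1)}`) and `S` (all lines at coarse slices: the replacement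
step, part Η, with Prop. 3.9's rate on one line at a time and «the degrees of some subgraphs reduced by γ»).  This file proves both members for King's `A = 0`
slices by name (parts Γ-b∕Γ-c∕Γ-d engines; Prop. 3.7 via `Prop37PrintedAt`; part Η-c's profiles) in the form part Γ-f assembles.  King's U(1)∕`A = 0` MODEL;
NOT Bałaban's non-abelian `G(U)` of [B9]; NOT a node discharge; nothing continuum ∕ ℝ⁴ ∕ OS ∕ mass-gap ∕ Clay.  0 `sorry`; standard axioms.
THE PRINT.  p. 663 [PDF 15]: *«G^{η′}_{k+n} = Σ_{j=−n}^{k−1} G^{η′}_{(j)} … (3.60) We divide the internal lines into two sets S and S^c … (3.61)»*; p. 664 [PDF 16]: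
*«Consider first a term on the right-hand side of (3.61) with S^c non-empty. … (3.70) … and (3.70) gives L^{−γk}. … So we reduce to the case with S^c empty»*;
p. 665 [PDF 17]: *«If we replace a propagator G^{η′}_{(j)}(x′, y′) by G^η_{(j)}(x, y), the error is the same graph with a difference of propagators on one line.
Redoing the analysis, we see that the degrees of some subgraphs have been reduced by γ; for γ small enough, the exponents D(H_i) − γ are still positive, and the
bound proceeds as before. This replacement is made for every internal line, and every ordering l.»*
WHAT THIS FILE PROVES (namespace `…N15KingModelRung.Curved`).
* §1 ★ `sum_assign_split` (the `S ∕ S^c` split of the fine assignments `j′ : lines → Fin (k+n)`: `Σ_{j′} F = Σ_{j′ : some line < n} F + Σ_{j : lines → Fin k} F (j + n)`);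
  `orderList_update_eq`, `orderList_lowerFinest_eq` (the lowered order lists as `ofFn`-lowerings), ★ `sum_degConst_le_of_margin` (`Σ_π degConst ≤ m!·((1 −
  L^{−γ₁∕2})^{−1})^m` under a margin `γ₁ − γ ≥ γ₁∕2`), `posDegreesBy_orderList_update`, `posDegreesBy_orderList_lowerFinest` (margins after one lowering).
* §2 ★★ **`king_graph_finest_small`** — THE `S^c` TERMS: `Σ_{j′ : some line < n} |E^{(K+n)}(H(j′))| ≤ L^{−γ(K+1)}·Γ·C₁^m·C₂^{#v−1}·(Σ_π degConst(finest-lowered))·Π q`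
  for the `(K+n)`-run's slices of King's `A = 0` propagator on the lines (`Prop37PrintedAt` of that run; any `C₁ ≥ C`, `C₂ ≥ c368`).
* §3 ★★ `sum_graphValLS_profileAt_le` (the profile majorant graphs — for ANY real line exponents — summed over all assignments, uniformly: part Γ-b with part Γ-d's
  profile letters), ★ `replacement_line_term_le` (the replacement term at Prop. 3.9's `γ_B` with gain `L^{−γ_BK}` ≤ the `γ`-lowered profile graph with gain
  `L^{−γK}`, any `γ ≤ γ_B`), `prod_erase_update_mul`.
HONEST SCOPE.  (a) Members only; the assembly `|E^{(K+n)}(H) − E^{(K)}(H)| ≤ …·L^{−γK}` is part Γ-f.  (b) Positivity ∕ margin of the degrees along every ordering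
is a HYPOTHESIS (§3.5 ∕ Thm 3.5 NOT typed); certificates are user data.  (c) King's U(1)∕`A = 0` model; `G`∕`∂G` lines; one-vertex factors abstract; NOT
Bałaban's `G(U)`; NE2∕N15 of record untouched; counts unmoved.  Locators: [King1986] (3.60)–(3.61) p.663, (3.66) p.663 (foot), (3.67)–(3.70) p.664, p.665,
Prop. 3.7 (3.63) p.663, Prop. 3.9 (3.73) p.665.
-/
noncomputable section

namespace Summit.QuantumFields.YangMills.BalabanUVNodes.N15KingModelRung.Curved

open scoped BigOperators
open Finset
open Literature.MathematicalPhysics.QuantumFieldTheory.Balaban1983to89.B5Prop11Plancherel (Tor fine unitVec)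
open Literature.MathematicalPhysics.QuantumFieldTheory.King1986.Torus (tdistT tdistT_nonneg tdistT_symm)
open Literature.MathematicalPhysics.QuantumFieldTheory.King1986.SlicePropagator (SliceKernels TwoSpacing Prop37PrintedAt Prop39PrintedAt)
open Literature.MathematicalPhysics.QuantumFieldTheory.King1986.ContinuumLimit (eps)
open Summit.QuantumFields.YangMills.BalabanUVNodes.N15KingModelRung (KingVolIndex kingVol kingVol_neZero)
open Summit.QuantumFields.YangMills.BalabanUVNodes.N15KingModelRung.Graph

variable {d : ℕ} (L : ℕ) [NeZero L]

/-! ## §1 The `S ∕ S^c` split of the fine run's slice assignments; lowered order lists -/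

section Split

omit [NeZero L] in
/-- **«WE DIVIDE THE INTERNAL LINES INTO TWO SETS S AND S^c»** for the fine run's slice assignments `j′ : lines → Fin (k + n)` (slices `0, …, k+n−1` of the
`(k+n)`-run; King's `j = j′ − n ∈ [−n, k−1]`): either SOME line is below `n` (`S^c ≠ ∅`), or every line is `≥ n` and `j′ = j + n` for a unique coarse
assignment `j : lines → Fin k` — `Σ_{j′} F j′ = Σ_{j′ : S^c ≠ ∅} F j′ + Σ_j F (j + n)`. [cite: King1986, (3.60)–(3.61) p.663] -/
theorem sum_assign_split {M : Type*} [AddCommMonoid M] (m k n : ℕ) (F : (Fin m → Fin (k + n)) → M) :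
    ∑ j' : Fin m → Fin (k + n), F j'
      = ∑ j' : Fin m → Fin (k + n), (if ∃ ℓ, ((j' ℓ : ℕ)) < n then F j' else 0)
        + ∑ j : Fin m → Fin k, F (fun ℓ => Fin.addNat (j ℓ) n) := by
  classical
  have h1 : ∑ j' : Fin m → Fin (k + n), F j'
      = ∑ j' : Fin m → Fin (k + n), (if ∃ ℓ, ((j' ℓ : ℕ)) < n then F j' else 0)
        + ∑ j' : Fin m → Fin (k + n), (if ∃ ℓ, ((j' ℓ : ℕ)) < n then 0 else F j') := by
    rw [← sum_add_distrib]
    exact sum_congr rfl fun j' _ => by split_ifs <;> simp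
  rw [h1]
  congr 1
  -- the `S` assignments are the shifted coarse ones
  have hinj : Function.Injective fun (j : Fin m → Fin k) (ℓ : Fin m) => Fin.addNat (j ℓ) n := by
    intro j₁ j₂ h
    funext ℓ
    have := congrFun h ℓ
    exact Fin.ext (by have h' := congrArg Fin.val this; simp [Fin.addNat] at h'; omega)
  rw [← sum_image fun j₁ _ j₂ _ h => hinj h]
  have hset : (univ : Finset (Fin m → Fin k)).image (fun (j : Fin m → Fin k) (ℓ : Fin m) => Fin.addNat (j ℓ) n)
      = univ.filter fun j' : Fin m → Fin (k + n) => ¬ ∃ ℓ, ((j' ℓ : ℕ)) < n := by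
    ext j'
    simp only [mem_image, mem_univ, true_and, mem_filter, not_exists, not_lt]
    constructor
    · rintro ⟨j, rfl⟩ ℓ
      simp [Fin.addNat]
    · intro h
      refine ⟨fun ℓ => ⟨(j' ℓ : ℕ) - n, by have := (j' ℓ).isLt; have := h ℓ; omega⟩, funext fun ℓ => Fin.ext ?_⟩
      have := h ℓ
      simp [Fin.addNat]
      omega
  rw [hset, sum_filter]
  exact sum_congr rfl fun j' _ => by
    by_cases h : ∃ ℓ, ((j' ℓ : ℕ)) < n
    · rw [if_pos h, if_neg (not_not.2 h)]
    · rw [if_neg h, if_pos h]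

end Split

section Lists
variable {n m : ℕ} {src tgt : Fin m → Fin (n + 1)}

omit [NeZero L] in
/-- the order list with ONE LINE's exponent lowered by `γ` is the `ofFn`-lowering of the order list at that line's position. [cite: King1986, p.665] -/
theorem orderList_update_eq (dV γ : ℝ) (e : Fin m → ℝ) (ℓ : Fin m) (π : Equiv.Perm (Fin m)) (F : ForestCert n src tgt) :
    orderList dV (Function.update e ℓ (e ℓ - γ)) π F
      = List.ofFn fun p : Fin m => (fun p : Fin m => orderExps dV e π F (Fin.rev p)) p - if p = Fin.rev (π.symm ℓ) then γ else 0 := by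
  unfold orderList
  congr 1
  funext p
  unfold orderExps
  dsimp only
  by_cases h : p = Fin.rev (π.symm ℓ)
  · subst h
    rw [if_pos rfl, Fin.rev_rev, Equiv.apply_symm_apply, Function.update_self]
    ring
  · have hne : π (Fin.rev p) ≠ ℓ := fun h' => h (by rw [← h', Equiv.symm_apply_apply, Fin.rev_rev])
    rw [if_neg h, Function.update_of_ne hne, sub_zero]

omit [NeZero L] in
/-- the finest-lowered order list is the `ofFn`-lowering of the order list at the last position (`m ≥ 1`). [cite: King1986, (3.70) p.664] -/
theorem orderList_lowerFinest_eq (hm : 0 < m) (dV γ : ℝ) (e : Fin m → ℝ) (π : Equiv.Perm (Fin m)) (F : ForestCert n src tgt) :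
    (List.ofFn fun p : Fin m => lowerFinest γ (orderExps dV e π F) (Fin.rev p))
      = List.ofFn fun p : Fin m => (fun p : Fin m => orderExps dV e π F (Fin.rev p)) p - if p = Fin.rev ⟨0, hm⟩ then γ else 0 := by
  congr 1
  funext p
  unfold lowerFinest
  dsimp only
  have hiff : ((Fin.rev p : ℕ)) = 0 ↔ p = Fin.rev ⟨0, hm⟩ := by
    constructor
    · intro h
      have h1 : Fin.rev p = ⟨0, hm⟩ := Fin.ext h
      rw [← h1, Fin.rev_rev]
    · rintro rfl
      rw [Fin.rev_rev]
  by_cases h : p = Fin.rev ⟨0, hm⟩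
  · rw [if_pos h, if_pos (hiff.2 h)]
  · rw [if_neg h, if_neg (fun h' => h (hiff.1 h'))]

omit [NeZero L] in
/-- ★ **THE DEGREE CONSTANTS UNDER A MARGIN, SUMMED OVER THE ORDERINGS**: lists of length `m` with margin `γ₁ − γ ≥ γ₁∕2` (the order lists lowered once by
`γ ≤ γ₁∕2`, or not at all) have `Σ_π degConst ≤ m!·((1 − L^{−γ₁∕2})^{−1})^m` — «again depending only on n̄».
[cite: King1986, p.664 («a sum over orderings of the lines, again depending only on n̄»), p.665] -/
theorem sum_degConst_le_of_margin (hL : 2 ≤ L) {γ₁ γ : ℝ} (hγ₁ : 0 < γ₁) (hγ : γ ≤ γ₁ / 2)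
    (f : Equiv.Perm (Fin m) → List ℝ) (hf : ∀ π, PosDegreesBy (γ₁ - γ) (f π) ∧ (f π).length = m) :
    ∑ π : Equiv.Perm (Fin m), degConst L (f π) ≤ (m.factorial : ℝ) * ((1 - (L : ℝ) ^ (-(γ₁ / 2)))⁻¹) ^ m := by
  have hmar : 0 < γ₁ / 2 := by linarith
  calc ∑ π : Equiv.Perm (Fin m), degConst L (f π) ≤ ∑ _π : Equiv.Perm (Fin m), ((1 - (L : ℝ) ^ (-(γ₁ / 2)))⁻¹) ^ m := by
        refine sum_le_sum fun π _ => ?_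
        have h := degConst_le_pow L hL hmar (posDegreesBy_mono (by linarith : γ₁ / 2 ≤ γ₁ - γ) (hf π).1)
        rwa [(hf π).2] at h
    _ = (m.factorial : ℝ) * ((1 - (L : ℝ) ^ (-(γ₁ / 2)))⁻¹) ^ m := by
        rw [sum_const, card_univ, Fintype.card_perm, Fintype.card_fin, nsmul_eq_mul]

omit [NeZero L] in
/-- the order lists lowered at ONE LINE keep a margin `γ₁ − γ` (King: «the degrees of some subgraphs have been reduced by γ»). [cite: King1986, p.665] -/
theorem posDegreesBy_orderList_update {γ₁ γ : ℝ} (hγ0 : 0 ≤ γ) (dV : ℝ) (e : Fin m → ℝ) (ℓ : Fin m) (π : Equiv.Perm (Fin m)) (F : ForestCert n src tgt)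
    (h : PosDegreesBy γ₁ (orderList dV e π F)) : PosDegreesBy (γ₁ - γ) (orderList dV (Function.update e ℓ (e ℓ - γ)) π F) := by
  rw [orderList_update_eq]
  exact posDegreesBy_ofFn_lower hγ0 _ _ h

omit [NeZero L] in
/-- the order lists lowered at THE FINEST POSITION keep a margin `γ₁ − γ` ((3.70)'s extraction). [cite: King1986, (3.70) p.664, p.665] -/
theorem posDegreesBy_orderList_lowerFinest {γ₁ γ : ℝ} (hγ0 : 0 ≤ γ) (dV : ℝ) (e : Fin m → ℝ) (π : Equiv.Perm (Fin m)) (F : ForestCert n src tgt)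
    (h : PosDegreesBy γ₁ (orderList dV e π F)) :
    PosDegreesBy (γ₁ - γ) (List.ofFn fun p : Fin m => lowerFinest γ (orderExps dV e π F) (Fin.rev p)) := by
  rcases Nat.eq_zero_or_pos m with hm0 | hm
  · subst hm0; simp [PosDegreesBy]
  · rw [orderList_lowerFinest_eq hm]
    exact posDegreesBy_ofFn_lower hγ0 _ _ h

end Lists

/-! ## §2 The `S^c` terms of the fine graph are small (King's lines, Prop. 3.7 of the `(K+n)`-run by name) -/

section PartA

/-- ★★ **«(3.70) GIVES L^{−γk}» FOR GENERAL GRAPHS AT `A = 0`**: for the `(K+n)`-run's graph values `E^{(K+n)}(H(j′))` (lines carrying the slices `G^{η′}_{(j′_ℓ)}`,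
`∂^{η′}_μG^{η′}_{(j′_ℓ)}` of King's `A = 0` propagator on `T_{η′}`, `0 ≤ j′_ℓ < K + n`), the sum over the assignments with SOME line finer than the coarse spacing
(`j′_ℓ < n`, King's `S^c ≠ ∅`) of `|E^{(K+n)}(H(j′))|` is at most `L^{−γ(K+1)}·Γ·C₁^m·C₂^{#vertices−1}·(Σ_π degConst(finest-lowered list))·Π q` — Prop. 3.7 of
the `(K+n)`-run by name for the sups and the vertex sums (part Γ-c §1), the generic `S^c` lemma (part Γ-d `sum_graphValLS_slices_lt_le`) and
`(L^{n−1}η′)^γ = L^{−γ(K+1)}`. [cite: King1986, (3.60)–(3.61) p.663, (3.70) p.664 («Consider first a term … with S^c non-empty … and (3.70) gives L^{−γk}»)] -/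
theorem king_graph_finest_small (hL : 2 ≤ L) {a msq : ℝ} {K n eM : ℕ} (hK : 1 ≤ K) (hn : 1 ≤ n) (M : Fin (d + 1) → ℕ) [∀ μ, NeZero (M μ)]
    (hM : ∀ μ, M μ = 2 * L ^ eM) {α C δ₀ C₁ C₂ : ℝ} (hC : 0 ≤ C) (hδ₀ : 0 < δ₀) (hC₁ : C ≤ C₁) (hC₂ : c368 d δ₀ ≤ C₂)
    (h37' : Prop37PrintedAt α (kingSliceKernels L (K + n) eM M hM (one_le_add_of_one_le hK n) a msq) C δ₀)
    {nn m : ℕ} (src tgt : Fin m → Fin (nn + 1)) (κ : Fin m → Option (Fin (d + 1))) {Υ : Type*} [Fintype Υ] [DecidableEq Υ]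
    (vtx : Υ → Fin (nn + 1)) (u' : Υ → Tor (fine (L ^ (K + n)) M) → ℝ) (qq : Υ → ℝ) (υ₀ : Υ) (hυ₀ : vtx υ₀ = 0)
    (hu' : ∀ υ, υ ≠ υ₀ → ∀ x', |u' υ x'| ≤ qq υ) {Γ : ℝ} (hΓ : ∑ x', (((L : ℝ) ^ (K + n))⁻¹) ^ (d + 1) * |u' υ₀ x'| ≤ Γ)
    (cert : Equiv.Perm (Fin m) → ForestCert nn src tgt) {γ : ℝ} (hγ : 0 ≤ γ)
    (hpos : ∀ π, PosDegrees (List.ofFn fun p : Fin m =>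
      lowerFinest γ (orderExps ((d + 1 : ℕ) : ℝ) (fun ℓ => lineExp (d + 1) (κ ℓ)) π (cert π)) (Fin.rev p))) :
    ∑ j' : Fin m → Fin (K + n), (if ∃ ℓ, ((j' ℓ : ℕ)) < n then
        |graphValLS ((((L : ℝ) ^ (K + n))⁻¹) ^ (d + 1)) src tgt
          (fun ℓ (x' y' : Tor (fine (L ^ (K + n)) M)) =>
            sliceLine (kingSliceKernels L (K + n) eM M hM (one_le_add_of_one_le hK n) a msq) (j' ℓ) (κ ℓ) x' y') vtx u'| else 0)
      ≤ (L : ℝ) ^ (-(γ * (K + 1 : ℕ))) * (Γ * (C₁ ^ m * C₂ ^ nn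
          * (∑ π : Equiv.Perm (Fin m), degConst L (List.ofFn fun p : Fin m =>
              lowerFinest γ (orderExps ((d + 1 : ℕ) : ℝ) (fun ℓ => lineExp (d + 1) (κ ℓ)) π (cert π)) (Fin.rev p)))
          * ∏ υ ∈ univ.erase υ₀, qq υ)) := by
  have hL1 : 1 ≤ L := by omega
  have hL0 : (0 : ℝ) < L := by exact_mod_cast (show 0 < L by omega)
  have hw0 : (0 : ℝ) ≤ (((L : ℝ) ^ (K + n))⁻¹) ^ (d + 1) := by positivity
  haveI : Nonempty (Tor (fine (L ^ (K + n)) M)) := ⟨fun _ => 0⟩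
  have hC₁0 : 0 ≤ C₁ := hC.trans hC₁
  have hC₂0 : 0 ≤ C₂ := (c368_pos d hδ₀).le.trans hC₂
  have hs0 : ∀ (c : Fin (K + n)) (ex : ℝ), 0 ≤ ((L : ℝ) ^ ((c : ℕ)) * eps L (K + n)) ^ ex := fun c ex =>
    Real.rpow_nonneg (by unfold eps; positivity) _
  -- the finest factor
  have hθ : ((L : ℝ) ^ (n - 1) * eps L (K + n)) ^ γ = (L : ℝ) ^ (-(γ * (K + 1 : ℕ))) := by
    rw [slice_rpow_eq L hL0 (n - 1) (K + n) γ]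
    congr 1
    rw [Nat.cast_sub hn]
    push_cast
    ring
  -- termwise the majorant graph
  have hterm : ∀ j' : Fin m → Fin (K + n),
      (if ∃ ℓ, ((j' ℓ : ℕ)) < n then
        |graphValLS ((((L : ℝ) ^ (K + n))⁻¹) ^ (d + 1)) src tgt
          (fun ℓ (x' y' : Tor (fine (L ^ (K + n)) M)) =>
            sliceLine (kingSliceKernels L (K + n) eM M hM (one_le_add_of_one_le hK n) a msq) (j' ℓ) (κ ℓ) x' y') vtx u'| else 0)
      ≤ (if ∃ ℓ, ((j' ℓ : ℕ)) < n then
        graphValLS ((((L : ℝ) ^ (K + n))⁻¹) ^ (d + 1)) src tgt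
          (fun ℓ => (fun (ℓ : Fin m) (c : Fin (K + n)) (x' y' : Tor (fine (L ^ (K + n)) M)) =>
            |sliceLine (kingSliceKernels L (K + n) eM M hM (one_le_add_of_one_le hK n) a msq) c (κ ℓ) x' y'|) ℓ (j' ℓ))
          vtx (fun υ x' => |u' υ x'|) else 0) := by
    intro j'
    split_ifs
    · have h := abs_graphValLS_le ((((L : ℝ) ^ (K + n))⁻¹) ^ (d + 1)) src tgt
        (fun ℓ (x' y' : Tor (fine (L ^ (K + n)) M)) =>
          sliceLine (kingSliceKernels L (K + n) eM M hM (one_le_add_of_one_le hK n) a msq) (j' ℓ) (κ ℓ) x' y') vtx u'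
      rw [abs_of_nonneg hw0] at h
      exact h
    · exact le_rfl
  refine (sum_le_sum fun j' _ => hterm j').trans ?_
  rw [← hθ]
  exact sum_graphValLS_slices_lt_le L hL (by omega : 1 ≤ K + n) vtx hw0
    (fun (ℓ : Fin m) (c : Fin (K + n)) (x' y' : Tor (fine (L ^ (K + n)) M)) =>
      |sliceLine (kingSliceKernels L (K + n) eM M hM (one_le_add_of_one_le hK n) a msq) c (κ ℓ) x' y'|)
    (fun ℓ c x y => abs_nonneg _) hC₁0 hC₂0 (((d + 1 : ℕ) : ℝ)) (fun ℓ => lineExp (d + 1) (κ ℓ))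
    (fun ℓ c x y => (abs_sliceLine_le_sup L (one_le_add_of_one_le hK n) M hM hC hδ₀.le h37' (by have := c.isLt; omega) (κ ℓ) x y).trans
      (mul_le_mul_of_nonneg_right hC₁ (hs0 c _)))
    (fun ℓ c y => (lineSum_sliceLine_le_row L hL1 (one_le_add_of_one_le hK n) M hM hC hδ₀ h37' (by have := c.isLt; omega) (κ ℓ) y).trans
      (mul_le_mul_of_nonneg_right (mul_le_mul hC₁ hC₂ (c368_pos d hδ₀).le hC₁0) (hs0 c _)))
    (fun ℓ c y => (lineSum_sliceLine_le_col L hL1 (one_le_add_of_one_le hK n) M hM hC hδ₀ h37' (by have := c.isLt; omega) (κ ℓ) y).trans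
      (mul_le_mul_of_nonneg_right (mul_le_mul hC₁ hC₂ (c368_pos d hδ₀).le hC₁0) (hs0 c _)))
    (fun υ x' => |u' υ x'|) (fun υ x' => abs_nonneg _) υ₀ hυ₀ hΓ qq hu' cert hγ hn hpos

end PartA

/-! ## §3 The replacement step's majorants summed over the assignments (the `S` terms' building block) -/

section PartB

/-- ★★ **THE MAJORANT GRAPHS OF THE REPLACEMENT STEP, SUMMED OVER ALL ASSIGNMENTS**: with (3.63)∕(3.73)-type profiles `profileAt C δ₀ c (e′_ℓ)` on the lines
(ANY real exponents `e′` — the size exponents `lineExp κ`, or those with one line lowered by `γ`), a root-placed `L¹` one-vertex majorant (`≤ Γ`) and sups `qq_υ`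
elsewhere, and `PosDegrees` of the order lists of `e′` along every ordering: `Σ_j 𝔼(H(j)) ≤ Γ·C₁^m·C₂^{#vertices−1}·(Σ_π degConst L (orderList … e′ π …))·Π qq` —
part Γ-b `sum_graphValLS_slices_le` with part Γ-d's profile letters (`C ≤ C₁`, `c368 ≤ C₂`). [cite: King1986, pp.664–665 (proof of Prop. 3.6), (3.63) p.663, (3.68) p.664] -/
theorem sum_graphValLS_profileAt_le (hL : 2 ≤ L) {K : ℕ} (hK : 1 ≤ K) (Mv : Fin (d + 1) → ℕ) [∀ μ, NeZero (Mv μ)]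
    {C δ₀ C₁ C₂ : ℝ} (hC : 0 ≤ C) (hδ₀ : 0 < δ₀) (hC₁ : C ≤ C₁) (hC₂ : c368 d δ₀ ≤ C₂)
    {nn m : ℕ} {src tgt : Fin m → Fin (nn + 1)} {Υ : Type*} [Fintype Υ] [DecidableEq Υ] (vtx : Υ → Fin (nn + 1)) (e' : Fin m → ℝ)
    (p : Υ → Tor (fine (L ^ K) Mv) → ℝ) (hp0 : ∀ υ x, 0 ≤ p υ x) (υ₀ : Υ) (hυ₀ : vtx υ₀ = 0) {Γ : ℝ}
    (hΓ : ∑ x, (((L : ℝ) ^ K)⁻¹) ^ (d + 1) * p υ₀ x ≤ Γ) (qq : Υ → ℝ) (hq : ∀ υ, υ ≠ υ₀ → ∀ x, p υ x ≤ qq υ)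
    (cert : Equiv.Perm (Fin m) → ForestCert nn src tgt) (hpos : ∀ π, PosDegrees (orderList ((d + 1 : ℕ) : ℝ) e' π (cert π))) :
    ∑ j : Fin m → Fin K, graphValLS ((((L : ℝ) ^ K)⁻¹) ^ (d + 1)) src tgt
        (fun ℓ (x y : Tor (fine (L ^ K) Mv)) => profileAt L K Mv C δ₀ (j ℓ) (e' ℓ) x y) vtx p
      ≤ Γ * (C₁ ^ m * C₂ ^ nn * (∑ π : Equiv.Perm (Fin m), degConst L (orderList ((d + 1 : ℕ) : ℝ) e' π (cert π))) * ∏ υ ∈ univ.erase υ₀, qq υ) := by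
  have hL1 : 1 ≤ L := by omega
  have hL0 : (0 : ℝ) < L := by exact_mod_cast (show 0 < L by omega)
  have hw0 : (0 : ℝ) ≤ (((L : ℝ) ^ K)⁻¹) ^ (d + 1) := by positivity
  haveI : Nonempty (Tor (fine (L ^ K) Mv)) := ⟨fun _ => 0⟩
  have hC₁0 : 0 ≤ C₁ := hC.trans hC₁
  have hC₂0 : 0 ≤ C₂ := (c368_pos d hδ₀).le.trans hC₂
  have hs0 : ∀ (c : Fin K) (ex : ℝ), 0 ≤ ((L : ℝ) ^ ((c : ℕ)) * eps L K) ^ ex := fun c ex => Real.rpow_nonneg (by unfold eps; positivity) _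
  exact sum_graphValLS_slices_le L hL hK vtx hw0
    (fun (ℓ : Fin m) (c : Fin K) (x y : Tor (fine (L ^ K) Mv)) => profileAt L K Mv C δ₀ c (e' ℓ) x y)
    (fun ℓ c x y => profileAt_nonneg L Mv hC δ₀ _ _ x y) hC₁0 hC₂0 (((d + 1 : ℕ) : ℝ)) e'
    (fun ℓ c x y => (profileAt_le_sup L Mv hC hδ₀.le _ _ x y).trans (mul_le_mul_of_nonneg_right hC₁ (hs0 c _)))
    (fun ℓ c y => (lineSum_profileAt_row L hL1 Mv hC hδ₀ _ _ y).trans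
      (mul_le_mul_of_nonneg_right (mul_le_mul hC₁ hC₂ (c368_pos d hδ₀).le hC₁0) (hs0 c _)))
    (fun ℓ c y => (lineSum_profileAt_col L hL1 Mv hC hδ₀ _ _ y).trans
      (mul_le_mul_of_nonneg_right (mul_le_mul hC₁ hC₂ (c368_pos d hδ₀).le hC₁0) (hs0 c _)))
    p hp0 υ₀ hυ₀ hΓ qq hq cert hpos

/-- ★ **«FOR γ SMALL ENOUGH» AT THE LEVEL OF THE MAJORANT GRAPH**: the replacement term with line `ℓ` reduced by Prop. 3.9's `γ_B` and the gain `L^{−γ_BK}` is at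
most the same term with any smaller `γ ≤ γ_B` and the gain `L^{−γK}` — and the latter IS the profile graph of the exponents `lineExp` lowered at `ℓ` by `γ`.
[cite: King1986, p.665 («for γ small enough, the exponents D(H_i) − γ are still positive»), (3.73) p.665] -/
theorem replacement_line_term_le {K : ℕ} (Mv : Fin (d + 1) → ℕ) [∀ μ, NeZero (Mv μ)] {C δ₀ γ γB : ℝ} (hC : 0 ≤ C) (hγB : γ ≤ γB)
    {nn m : ℕ} (src tgt : Fin m → Fin (nn + 1)) {Υ : Type*} [Fintype Υ] [DecidableEq Υ] (vtx : Υ → Fin (nn + 1))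
    (κ : Fin m → Option (Fin (d + 1))) (p : Υ → Tor (fine (L ^ K) Mv) → ℝ) (hp0 : ∀ υ x, 0 ≤ p υ x) (j : Fin m → Fin K) (ℓ : Fin m) :
    (L : ℝ) ^ (-(γB * K)) * graphValLS ((((L : ℝ) ^ K)⁻¹) ^ (d + 1)) src tgt
        (Function.update (fun ℓ' (x y : Tor (fine (L ^ K) Mv)) => profileAt L K Mv C δ₀ (j ℓ') (lineExp (d + 1) (κ ℓ')) x y) ℓ
          (fun x y => profileAt L K Mv C δ₀ (j ℓ) (lineExp (d + 1) (κ ℓ) - γB) x y)) vtx p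
      ≤ (L : ℝ) ^ (-(γ * K)) * graphValLS ((((L : ℝ) ^ K)⁻¹) ^ (d + 1)) src tgt
        (fun ℓ' (x y : Tor (fine (L ^ K) Mv)) =>
          profileAt L K Mv C δ₀ (j ℓ') (Function.update (fun ℓ'' => lineExp (d + 1) (κ ℓ'')) ℓ (lineExp (d + 1) (κ ℓ) - γ) ℓ') x y) vtx p := by
  classical
  have hw0 : (0 : ℝ) ≤ (((L : ℝ) ^ K)⁻¹) ^ (d + 1) := by
    have hL0 : (0 : ℝ) ≤ L := Nat.cast_nonneg L
    positivity
  -- the target family is the `γ`-reduced update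
  have hupd : (fun ℓ' (x y : Tor (fine (L ^ K) Mv)) =>
        profileAt L K Mv C δ₀ (j ℓ') (Function.update (fun ℓ'' => lineExp (d + 1) (κ ℓ'')) ℓ (lineExp (d + 1) (κ ℓ) - γ) ℓ') x y)
      = Function.update (fun ℓ' (x y : Tor (fine (L ^ K) Mv)) => profileAt L K Mv C δ₀ (j ℓ') (lineExp (d + 1) (κ ℓ')) x y) ℓ
          (fun x y => profileAt L K Mv C δ₀ (j ℓ) (lineExp (d + 1) (κ ℓ) - γ) x y) := by
    funext ℓ' x y
    by_cases h : ℓ' = ℓ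
    · subst h; rw [Function.update_self, Function.update_self]
    · rw [Function.update_of_ne h, Function.update_of_ne h]
  rw [hupd, ← graphValLS_line_update_mul, ← graphValLS_line_update_mul]
  refine graphValLS_mono src tgt vtx hw0 _ _ p p (fun ℓ' x y => ?_) (fun ℓ' x y => ?_) hp0 (fun υ x => le_rfl)
  · by_cases h : ℓ' = ℓ
    · subst h; rw [Function.update_self]
      exact mul_nonneg (Real.rpow_nonneg (Nat.cast_nonneg L) _) (profileAt_nonneg L Mv hC δ₀ _ _ x y)
    · rw [Function.update_of_ne h]; exact profileAt_nonneg L Mv hC δ₀ _ _ x y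
  · by_cases h : ℓ' = ℓ
    · subst h; rw [Function.update_self, Function.update_self]
      exact rate_profileAt_mono L Mv hC hγB _ _ x y
    · rw [Function.update_of_ne h, Function.update_of_ne h]

omit [NeZero L] in
/-- the product of the sups with ONE factor replaced: `Π_{υ ≠ υ₀} (qq[υ ↦ s·qq_υ]) = s·Π_{υ ≠ υ₀} qq` (`υ ≠ υ₀`). [folklore] -/
theorem prod_erase_update_mul {Υ : Type*} [Fintype Υ] [DecidableEq Υ] (qq : Υ → ℝ) (υ₀ υ : Υ) (hυ : υ ≠ υ₀) (sc : ℝ) :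
    ∏ υ' ∈ univ.erase υ₀, Function.update qq υ (sc * qq υ) υ' = sc * ∏ υ' ∈ univ.erase υ₀, qq υ' := by
  have hmem : υ ∈ univ.erase υ₀ := mem_erase.2 ⟨hυ, mem_univ υ⟩
  rw [prod_update_of_mem hmem, ← mul_prod_erase (univ.erase υ₀) qq hmem, sdiff_singleton_eq_erase, mul_assoc]

end PartB

end Summit.QuantumFields.YangMills.BalabanUVNodes.N15KingModelRung.Curved

end
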